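import Literature.NumberTheory.EllipticCurves.Greenberg1999.LocalH1DivisibleCyclotomic
import Literature.NumberTheory.EllipticCurves.ZpExtension
import Literature.NumberTheory.EllipticCurves.SubgroupSelmer
import Literature.NumberTheory.EllipticCurves.GeomPointsGaloisModule
import Literature.NumberTheory.EllipticCurves.TateModule
import Literature.NumberTheory.EllipticCurves.IwasawaSelmerSupersingularLocalProofs
import Literature.NumberTheory.GaloisRepresentations.LocalZpTowerCdOne
import Literature.NumberTheory.GaloisRepresentations.LocalCyclotomicCharacterInfinite
import Literature.NumberTheory.GaloisRepresentations.LocalKroneckerWeberInertiaProofs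
import Literature.NumberTheory.GaloisRepresentations.LocalGaloisGroupFrobeniusProofs
import Literature.NumberTheory.GaloisRepresentations.DecompositionGroupOfCompletion
import Literature.NumberTheory.GaloisRepresentations.CyclotomicCharacterFrobeniusProofs
import Literature.NumberTheory.GaloisRepresentations.ContinuousCohomologyConnecting
import Literature.NumberTheory.GaloisRepresentations.AbsGaloisGroupCompact
import Literature.NumberTheory.GaloisRepresentations.PadicAlgebraOfLocalField
import Literature.NumberTheory.Automorphic.AdicCompletionResidueCard
import HarnessLib

/-!
# Proof of Greenberg's divisibility `H¹((K_∞)_η, E[p^∞])` divisible (LNM 1716 §4, Lemma 4.5 and the paragraph after it)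

This file DISCHARGES the named fact
`Literature.NumberTheory.EllipticCurves.Greenberg1999.localH1_primaryTorsion_divisible_cyclotomic`
(`LocalH1DivisibleCyclotomic.lean`; consumers: `Summits/BirchSwinnertonDyer/Rank1Residual/Additive/
PotSupersingular{,Gss,Tame}LocalH1Vanishing`, `PotSupersingularWildNotCotorsion` — all bind
`….{0}`) at universe `0`, the universe of the tree's Frobenius-value theorem
`GaloisRep.cyclotomicCharacter_frob_not_isOfFinOrder`:

* `localH1_primaryTorsion_divisible_cyclotomic_holds` — for `K` a number field, `E = W/K` elliptic,
  `p` prime, `κ` the CYCLOTOMIC `ℤ_p`-extension and `v` ANY finite place: every class of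
  `H¹((ker κ)_v, E(K̄_v)[p^∞])` is `p • c'`.

Proof, as printed (Greenberg §4 after Lemma 4.5, §2 proof of Prop. 2.4; Serre CG II §3.3 Prop. 9):
(1) `(ker κ)_v = ker(κ ∘ res_v)` and `κ ∘ res_v : Γ_{K_v} → ℤ_p` is NOT trivial — for `v ∤ p` a
Frobenius of `K_v` has `χ_p = N v` of infinite order (`GaloisRep.cyclotomicCharacter_frob_not_isOfFinOrder`),
for `v ∣ p` the local cyclotomic character has a value of infinite order
(`exists_cyclotomicCharacter_not_mem_torsion`, `LocalCyclotomicCharacterInfinite`) — so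
`cd_p((ker κ)_v) ≤ 1` (`groupCdLE_one_ker_of_apply_ne_one`, `LocalZpTowerCdOne`); (2) hence
`H²((ker κ)_v, E(K̄_v)[p]) = 0`; (3) the sequence `0 → E[p^∞][p] → E[p^∞] →ᵖ E[p^∞] → 0` of discrete
`(ker κ)_v`-modules is short exact (`E(K̄_v)` is divisible, `nsmul_surjective_localPoints`) and
`H¹(p) = p`, so by exactness at `H¹` (`IsSES.exists_map_one_eq_of_δ₁_eq_zero`) every class is a
`p`-th multiple (Greenberg's Lemma 4.5 with `n = 1`).

HONEST FRAMING (BSD rank-`≤ 1` residual cell `b2b-bsdres`, team n1011, seat p12 GEN 13, row T-CDL):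
research route on the CONSTRUCTION-SHAPED class O6; a named fact becomes a theorem (debt −1);
nothing booked, no mark moves.  Theorems only.

## References
* R. Greenberg, *Iwasawa theory for elliptic curves*, LNM 1716 (1999), §4 Lemma 4.5 and the
  paragraph following it; §2 (proof of Prop. 2.4). [GreenbergLNM1716]
* J.-P. Serre, *Cohomologie galoisienne* (1997), II §3.3 Prop. 9; I §2.2. [SerreGaloisCohomology1997]
-/

noncomputable section

open scoped Classical NNReal

open CategoryTheory Function NumberField IsDedekindDomain Field
open Literature.NumberTheory.GaloisRepresentations Literature.NumberTheory.EllipticCurves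
open scoped ContRepresentation

universe u

namespace Literature.NumberTheory.GaloisRepresentations

/-! ### Generic: `H¹(Γ, M)` is `n`-divisible when `M` is `n`-divisible and `H²(Γ, M[n]) = 0` -/

section Generic

variable {Γ : Type u} [Group Γ] [TopologicalSpace Γ] [IsTopologicalGroup Γ] [CompactSpace Γ]
variable {M₁ : Type u} [AddCommGroup M₁] [TopologicalSpace M₁] [DiscreteTopology M₁]
variable {M : Type u} [AddCommGroup M] [TopologicalSpace M] [DiscreteTopology M]
variable {ρ₁ : ContinuousRep Γ ℤ M₁} {ρ : ContinuousRep Γ ℤ M}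

/-- **Greenberg, LNM 1716, Lemma 4.5 (`n = 1`) in cochain form**: for a short exact sequence
`0 → M₁ → M →ᵍ M → 0` of discrete `Γ`-modules whose second map induces multiplication by `n` on
`H¹(Γ, M)`, the vanishing `H²(Γ, M₁) = 0` makes every class of `H¹(Γ, M)` an `n`-th multiple
(exactness of `H¹(Γ, M) →ᵍ H¹(Γ, M) →^{δ₁} H²(Γ, M₁)`).
[cite: GreenbergLNM1716, §4 Lemma 4.5] [cite: SerreGaloisCohomology1997, I §2.2] -/
theorem exists_eq_nsmul_of_isSES_of_subsingleton_two {f : ρ₁.toTopRep ⟶ ρ.toTopRep}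
    {g : ρ.toTopRep ⟶ ρ.toTopRep} (hSES : IsSES f g) {n : ℕ}
    (hg : ∀ y : continuousCohomology 1 ρ.toTopRep, cohomologyMap g 1 y = n • y)
    (h2 : Subsingleton (continuousCohomology 2 ρ₁.toTopRep))
    (c : continuousCohomology 1 ρ.toTopRep) :
    ∃ c' : continuousCohomology 1 ρ.toTopRep, c = n • c' := by
  obtain ⟨y, hy⟩ := hSES.exists_map_one_eq_of_δ₁_eq_zero c (Subsingleton.elim _ _)
  exact ⟨y, by rw [← hy, hg]⟩

end Generic

end Literature.NumberTheory.GaloisRepresentations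

namespace Literature.NumberTheory.EllipticCurves.Greenberg1999

open IsDedekindDomain.HeightOneSpectrum

/-! ### The local `ℤ_p`-tower of the cyclotomic extension is non-trivial at every finite place -/

/-- **No finite place splits completely in the cyclotomic `ℤ_p`-extension**: for `κ` cyclotomic and
ANY finite `v` there is `σ ∈ Γ_{K_v}` with `κ(res_v σ) ≠ 1`.  For `v ∤ p`: a Frobenius `σ` of `K_v`
(`exists_isAbsArithFrob_holds`) restricts to an arithmetic Frobenius at the prime above `v` cut out by
the chosen embedding (`isArithFrobAt_absGaloisRestrict_adicCompletionPrime_iff`), whose cyclotomic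
character `N v` has infinite order (`GaloisRep.cyclotomicCharacter_frob_not_isOfFinOrder`); for
`v ∣ p`: some `χ_p^{K_v}(σ)` has infinite order (`exists_cyclotomicCharacter_not_mem_torsion`) and
`χ_p^K ∘ res_v = χ_p^{K_v}` (`cyclotomicCharacter_absGaloisRestrict`); in both cases
`res_v σ ∉ χ_p⁻¹(μ(ℤ_p)) = ker κ` (`ZpExtension.IsCyclotomic`).  (`K : Type`.)
[cite: GreenbergLNM1716, §1 ("Gal((F_∞)_η/F_v) ≅ ℤ_p" for every non-archimedean v), §4 (after Lemma 4.5)]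
[cite: Washington1997, §13.1] -/
theorem exists_apply_resGal_ne_one_of_isCyclotomic {K : Type} [Field K] [NumberField K]
    {p : ℕ} [Fact p.Prime] {κ : ZpExtension K p} (hκ : κ.IsCyclotomic)
    (v : HeightOneSpectrum (𝓞 K)) :
    ∃ σ : absoluteGaloisGroup (v.adicCompletion K), κ (resGal (K := K) (v.adicCompletion K) σ) ≠ 1 := by
  have hp : p.Prime := Fact.out
  haveI : NeZero (p : K) := NeZero.charZero
  -- membership in `ker κ` means a torsion cyclotomic character
  have hker : ∀ τ : absoluteGaloisGroup K, κ τ = 1 →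
      GaloisRep.cyclotomicCharacter K p τ ∈ CommGroup.torsion ℤ_[p]ˣ := by
    intro τ hτ
    have hmem : τ ∈ κ.kerSubgroup := hτ
    rw [show κ.kerSubgroup = _ from hκ, Subgroup.mem_comap] at hmem
    exact hmem
  by_cases hpv : (p : 𝓞 K) ∈ v.asIdeal
  · -- `v ∣ p`: the local cyclotomic character has a value of infinite order
    haveI : CharZero (v.adicCompletion K) := LocalField.charZero_adicCompletion v
    have hval : ValuativeRel.valuation (v.adicCompletion K) (p : v.adicCompletion K) < 1 :=
      LocalField.valuation_adicCompletion_natCast_lt_one v p hpv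
    obtain ⟨σ, hσ⟩ := exists_cyclotomicCharacter_not_mem_torsion (v.adicCompletion K) (p := p) hval
    refine ⟨σ, fun h1 => hσ ?_⟩
    have h2 := hker _ h1
    have h3 : resGal (K := K) (v.adicCompletion K) σ = absGaloisRestrict K (v.adicCompletion K) σ := rfl
    rw [h3, cyclotomicCharacter_absGaloisRestrict K (v.adicCompletion K) p σ] at h2
    exact h2
  · -- `v ∤ p`: Frobenius
    obtain ⟨τ, hτ⟩ := exists_isAbsArithFrob_holds (F := v.adicCompletion K)
    refine ⟨τ, fun h1 ↦ ?_⟩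
    have hq : IsNonarchimedeanLocalField.residueFieldCard (v.adicCompletion K) =
        Nat.card (𝓞 K ⧸ v.asIdeal) := by
      rw [Literature.NumberTheory.Automorphic.residueFieldCard_adicCompletion_eq,
        HeightOneSpectrum.residueCard_eq_card_quotient]
    have hfrob := (isArithFrobAt_absGaloisRestrict_adicCompletionPrime_iff K v hq τ).2 hτ
    have hinf := GaloisRep.cyclotomicCharacter_frob_not_isOfFinOrder (ℓ := p) hpv
      (adicCompletionPrime_mem_primesAbove K v) hfrob
    have h2 := hker _ h1
    have h3 : resGal (K := K) (v.adicCompletion K) τ = absGaloisRestrict K (v.adicCompletion K) τ := rfl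
    rw [h3] at h2
    exact hinf ((CommGroup.mem_torsion _).1 h2)

/-! ### `cd_p((ker κ)_v) ≤ 1` -/

/-- **`cd_p(Gal(K̄_v/(K_∞)_η)) ≤ 1` for the cyclotomic `ℤ_p`-extension `K_∞/K` and EVERY finite place
`v`** ("`G_{(F_∞)_η}` has `p`-cohomological dimension `1`", Greenberg §4; Serre CG II §3.3 Prop. 9):
`(ker κ)_v = ker(κ ∘ res_v)` with `κ ∘ res_v` non-trivial (`exists_apply_resGal_ne_one_of_isCyclotomic`),
and `groupCdLE_one_ker_of_apply_ne_one`.  (`K : Type`.)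
[cite: GreenbergLNM1716, §4 (paragraph after Lemma 4.5), §2 (proof of Prop. 2.4)]
[cite: SerreGaloisCohomology1997, II §3.3 Prop. 9] -/
theorem groupCdLE_one_localSubgroup_kerSubgroup_of_isCyclotomic {K : Type} [Field K] [NumberField K]
    {p : ℕ} [Fact p.Prime] {κ : ZpExtension K p} (hκ : κ.IsCyclotomic)
    (v : HeightOneSpectrum (𝓞 K)) :
    GroupCdLE (localSubgroup κ.kerSubgroup (v.adicCompletion K)) p 1 := by
  haveI : CharZero (v.adicCompletion K) := LocalField.charZero_adicCompletion v
  set φ : absoluteGaloisGroup (v.adicCompletion K) →ₜ* Multiplicative ℤ_[p] :=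
    κ.toContinuousMonoidHom.comp (resGal (K := K) (v.adicCompletion K)) with hφdef
  have hker : localSubgroup κ.kerSubgroup (v.adicCompletion K) = φ.toMonoidHom.ker := by
    ext σ
    rw [mem_localSubgroup_iff, ZpExtension.mem_kerSubgroup, MonoidHom.mem_ker]
    rfl
  have hφ : ∃ σ, φ σ ≠ 1 := by
    obtain ⟨σ, hσ⟩ := exists_apply_resGal_ne_one_of_isCyclotomic hκ v
    exact ⟨σ, hσ⟩
  rw [hker]
  exact groupCdLE_one_ker_of_apply_ne_one (v.adicCompletion K) φ hφ

/-! ### The discharge -/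

/-- **Discharge of `localH1_primaryTorsion_divisible_cyclotomic`** (Greenberg, LNM 1716, §4, Lemma
4.5 and the paragraph following it: "`G_{(F_∞)_η}` has `p`-cohomological dimension 1. Hence
`H¹((F_∞)_η, E[p^∞])` must be divisible"), at universe `0` (the universe of the tree's
Frobenius-value theorem; every consumer binds `.{0}`): for `K` a number field, `E = W/K` elliptic,
`p` prime, `κ` the cyclotomic `ℤ_p`-extension and `v` ANY finite place, every class of
`H¹((ker κ)_v, E(K̄_v)[p^∞])` is divisible by `p`.  Proof:
`cd_p((ker κ)_v) ≤ 1` (`groupCdLE_one_localSubgroup_kerSubgroup_of_isCyclotomic`) kills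
`H²((ker κ)_v, E[p^∞][p])`; the short exact sequence `0 → E[p^∞][p] → E[p^∞] →ᵖ E[p^∞] → 0` of
discrete `(ker κ)_v`-modules (`E(K̄_v)` is divisible, `nsmul_surjective_localPoints`) then gives the
claim by exactness at `H¹` (`exists_eq_nsmul_of_isSES_of_subsingleton_two`).
[cite: GreenbergLNM1716, §4, Lemma 4.5 and the paragraph following it; §2, proof of Prop. 2.4]
[cite: SerreGaloisCohomology1997, II §3.3 Prop. 9] -/
theorem localH1_primaryTorsion_divisible_cyclotomic_holds :
    localH1_primaryTorsion_divisible_cyclotomic.{0} := by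
  intro K _ _ W _ p _ κ hκ v c
  have hp : p.Prime := Fact.out
  -- notation
  let Kv := v.adicCompletion K
  let Γv := absoluteGaloisGroup Kv
  let G : Subgroup Γv := localSubgroup κ.kerSubgroup Kv
  let M := AddCommGroup.primaryComponent (localPoints W Kv) p
  haveI : CompactSpace Γv := absoluteGaloisGroup_compactSpace Kv
  have hGclosed : IsClosed ((G : Subgroup Γv) : Set Γv) := by
    change IsClosed ((localSubgroup κ.kerSubgroup Kv : Subgroup Γv) : Set Γv)
    rw [localSubgroup_eq_comap, Subgroup.coe_comap]
    exact κ.isClosed_kerSubgroup.preimage (map_continuous (resGal (K := K) Kv))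
  haveI : CompactSpace G := isCompact_iff_compactSpace.mp hGclosed.isCompact
  -- the discrete `G`-module `M = E(K̄_v)[p^∞]` as a `ContinuousRep`
  let ρ0 : Representation ℤ G M :=
    { toFun := fun σ => (DistribSMul.toAddMonoidHom M σ).toIntLinearMap
      map_one' := by ext m; simp
      map_mul' := fun σ τ => by ext m; simp [mul_smul] }
  have hρ0 : ∀ (σ : G) (m : M), ρ0 σ m = σ • m := fun _ _ => rfl
  have hstab : ∀ m : M, {σ : G | ρ0 σ m = m} ∈ nhds (1 : G) := by
    intro m
    have hopen : IsOpen {σ : G | ρ0 σ m = m} := by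
      have h := (W.isOpen_stabilizer_localPoints Kv (m : localPoints W Kv)).preimage
        (continuous_subtype_val : Continuous (Subtype.val : G → Γv))
      convert h using 1
      ext σ
      simp only [Set.mem_setOf_eq, Set.mem_preimage, SetLike.mem_coe, hρ0]
      rw [Subtype.ext_iff, primaryComponent.coe_smul]
      rfl
    exact hopen.mem_nhds (by simp [hρ0])
  let ρM : ContinuousRep G ℤ M := ContinuousRep.ofStabilizerMemNhdsOne ρ0 hstab
  have hρM : ∀ (σ : G) (m : M), ρM σ m = σ • m := fun _ _ => rfl
  -- the `p`-torsion subrepresentation and the two morphisms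
  let T : Submodule ℤ M := Submodule.torsionBy ℤ M (p : ℤ)
  have hT : ∀ σ : G, T ≤ T.comap (ρM σ) := by
    intro σ m hm
    rw [Submodule.mem_comap, Submodule.mem_torsionBy_iff, ← map_smul,
      (Submodule.mem_torsionBy_iff (p : ℤ) m).1 hm, map_zero]
  let ρT : ContinuousRep G ℤ T := ρM.subrepresentation T hT
  let ι : ρT.toTopRep ⟶ ρM.toTopRep :=
    TopRep.ofHom ⟨⟨T.subtype, continuous_subtype_val⟩, fun σ => by ext m; rfl⟩
  let π : ρM.toTopRep ⟶ ρM.toTopRep :=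
    TopRep.ofHom ⟨⟨(p : ℤ) • LinearMap.id, continuous_of_discreteTopology⟩, fun σ => by
      apply ContinuousLinearMap.ext
      intro m
      change (p : ℤ) • (ρM σ m) = ρM σ ((p : ℤ) • m)
      rw [map_smul]⟩
  -- `M = E(K̄_v)[p^∞]` is `p`-divisible
  have hdiv : Function.Surjective fun m : M => (p : ℤ) • m := by
    intro m
    obtain ⟨Q, hQ⟩ := W.nsmul_surjective_localPoints Kv hp.ne_zero (m : localPoints W Kv)
    have hQmem : Q ∈ AddCommGroup.primaryComponent (localPoints W Kv) p := by
      obtain ⟨k, hk⟩ := m.2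
      refine ⟨k + 1, ?_⟩
      have hQ' : p • Q = (m : localPoints W Kv) := hQ
      rw [pow_succ, mul_smul, hQ']
      exact hk
    refine ⟨⟨Q, hQmem⟩, Subtype.ext ?_⟩
    change (p : ℤ) • Q = (m : localPoints W Kv)
    rw [natCast_zsmul]
    exact hQ
  have hSES : IsSES ι π :=
    { comp_eq_zero := by
        ext m
        exact congrArg Subtype.val ((Submodule.mem_torsionBy_iff (p : ℤ) (m : M)).1 m.2)
      injective := Subtype.val_injective
      exact_mid := fun y hy => ⟨⟨y, (Submodule.mem_torsionBy_iff (p : ℤ) y).2 hy⟩, rfl⟩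
      surjective := hdiv }
  -- `H¹(π) = p`
  have hπ : ∀ y : continuousCohomology 1 ρM.toTopRep, cohomologyMap π 1 y = p • y := by
    intro y
    obtain ⟨ψ, rfl⟩ := oneCocycleClass_surjective ρM.toTopRep y
    rw [cohomologyMap_oneCocycleClass, ← Nat.cast_smul_eq_nsmul ℤ p]
    have h1 : contOneCocycles.pullback (ContinuousMonoidHom.id _) (resIdHom π) ψ = (p : ℤ) • ψ :=
      Subtype.ext (ContinuousMap.ext fun σ => rfl)
    rw [h1]
    exact oneCocycleClass_smul (X := ρM.toTopRep) (p : ℤ) ψ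
  -- `H²(G, M[p]) = 0` from `cd_p(G) ≤ 1`
  have hcd := groupCdLE_one_localSubgroup_kerSubgroup_of_isCyclotomic (K := K) hκ v
  have hTp : IsPrimaryTorsion p T := fun t => ⟨1, by
    apply Subtype.ext
    rw [pow_one]
    change ((p • t : T) : M) = 0
    rw [Submodule.coe_smul_of_tower, ← natCast_zsmul]
    exact (Submodule.mem_torsionBy_iff (p : ℤ) (t : M)).1 t.2⟩
  have h2 : Subsingleton (continuousCohomology 2 ρT.toTopRep) :=
    hcd T ρT hTp (by norm_num : 1 < 2)
  -- conclusion
  exact exists_eq_nsmul_of_isSES_of_subsingleton_two hSES hπ h2 c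

end Literature.NumberTheory.EllipticCurves.Greenberg1999

end
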